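import Summits.ResolutionOfSingularities.ResolutionOfSingularities.Theorems.UniversalCellsCampaignW82KunzTwistCriterion
import Literature.AlgebraicGeometry.Resolution.CanonicalResolutionProofs
import Literature.AlgebraicGeometry.Resolution.CompletedPullbackRegular
import Mathlib.AlgebraicGeometry.Morphisms.Integral
import Mathlib.AlgebraicGeometry.Morphisms.UniversallyInjective
import HarnessLib

/-!
# [OURS · L1 W8.2] The regular-twist criterion POINTWISE: the smooth locus of a variety over `M(t)` (`M` perfect)
# is the image of the REGULAR LOCUS OF ITS FROBENIUS TWIST — the non-smooth locus is read off `Sing(Y^{(p)})`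

Cell `res-hironaka` (run/shared/lean/pub/res-hironaka/), LADDER-RESOLUTION rung L (RESCUE), slot W8.2; host route
`UniversalCells`, host item `PrimeFieldToPerfect` (stmt-ResolutionOfSingularities-15233), door 1. Theses-free
proofs file, written by res-L1-s82-pv-1 (gen 5), localising `smooth_iff_isRegular_frobeniusTwist`
(…RegularTwistCriterion, KERNEL.md §2 (E3)).

* `isIntegral_frobenius`, `isIntegralHom_specMap_frobenius`, `universallyInjective_specMap_frobenius` — `Spec Frob_K`
  is integral (hence universally closed) and universally injective, for any field `K` of characteristic `p`; so
  the projection `pr₁ : Y^{(p)} → Y` is a closed injective (indeed bijective) map.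
* `quasiCompact_ι_of_isNoetherian` — opens of a Noetherian scheme have quasi-compact inclusion.
* **`exists_smooth_nhds_iff_isRegularLocalRing_twist`** — over `K = M(t)`, `M` PERFECT, `q : Y → Spec K` of finite
  type, `y'` a point of the twist `Y^{(p)} = Y ×_{K,Frob} K` over `y = pr₁ y'`: «`q` is smooth on some open
  neighbourhood of `y`» iff «`𝒪_{Y^{(p)},y'}` is a regular local ring». (⇒: (E3) on the neighbourhood, whose twist
  is an open subscheme of `Y^{(p)}`; ⇐: the regular locus of `Y^{(p)}` is open (Matsumura 30.5, tree
  `isOpen_regularLocus_of_locallyOfFiniteType_field`), `pr₁` is closed and injective, so some open `U ∋ y` has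
  `pr₁⁻¹ U` regular, and (E3) makes `U` smooth.)
* **`smoothNhds_eq_image_regularLocus_twist`**, `isOpen_smoothNhds` — the set of points of `Y` at which `q` is smooth
  nearby EQUALS `pr₁ (Reg Y^{(p)})`, and is open. For the W8.2 residual: a resolution `Y → X₀^{(p^e)}` is the
  wanted one iff `Sing(Y^{(p)}) = ∅`; in general its defect is the closed set `pr₁(Sing Y^{(p)}) ⊂ Y`.
* `smooth_iff_forall_exists_smooth_nhds` — global from local: `q` smooth iff smooth near every point (through the
  twist: `Y^{(p)}` regular iff regular at every point).
* (appended) In Mathlib's vocabulary `Scheme.Hom.smoothLocus`: `mem_smoothLocus_iff_exists_smooth_nhds` (any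
  `g` locally of finite presentation), **`preimage_fst_smoothLocus_eq_regularLocus_twist`** (`pr₁⁻¹ (sm q) =
  Reg Y^{(p)}`), **`smoothLocus_eq_image_regularLocus_twist`** (`sm q = pr₁ (Reg Y^{(p)})`),
  `smooth_iff_regularLocus_twist_eq_univ` (`q` smooth iff `Sing Y^{(p)} = ∅`).

HONEST FRAMING. OURS theorems (role replaced: §17 ¶2 p.89 l.59–62 of [Hironaka2017], typed AS PRINTED as
`S17Methodology.U89_3`); NOT statements of the manuscript; nothing attributed to its author; a localisation of the
slot's criterion, not progress on the open residual. AI work, weaker than expert review; no claim beyond the kernel.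
-/

noncomputable section

set_option linter.dupNamespace false -- mandated namespace of this single-conjunct summit

open CategoryTheory CategoryTheory.Limits AlgebraicGeometry TopologicalSpace Polynomial
open Literature.AlgebraicGeometry.Resolution Literature.AlgebraicGeometry.Motives

namespace Summit.ResolutionOfSingularities.ResolutionOfSingularities.Theorems.CampaignW82

/-! ## `Spec Frob_K` is integral and universally injective -/

section AnyField

variable (p : ℕ) [Fact p.Prime] (K : Type) [Field K] [CharP K p]

/-- The Frobenius of a ring of characteristic `p` is an integral ring map: `a` is a root of the monic
`X ^ p − C a ∈ K[X]` mapped along `Frob` (`Frob a = a ^ p`). [folklore] -/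
theorem isIntegral_frobenius : (frobenius K p).IsIntegral := by
  intro a
  refine ⟨X ^ p - C a, monic_X_pow_sub_C a (Fact.out : p.Prime).ne_zero, ?_⟩
  simp only [eval₂_sub, eval₂_X_pow, eval₂_C, frobenius_def, sub_self]

/-- `Spec Frob_K : Spec K → Spec K` is an integral morphism (hence universally closed). [folklore] -/
theorem isIntegralHom_specMap_frobenius : IsIntegralHom (Spec.map (CommRingCat.ofHom (frobenius K p))) :=
  IsIntegralHom.SpecMap_iff.mpr (by
    change (frobenius K p).IsIntegral
    exact isIntegral_frobenius p K)

/-- `Spec Frob_K` is universally injective (it is the absolute Frobenius of `Spec K`, which is radicial).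
[folklore] -/
theorem universallyInjective_specMap_frobenius :
    UniversallyInjective (Spec.map (CommRingCat.ofHom (frobenius K p))) := by
  rw [← absoluteFrobenius_Spec_eq p K (natCast_sections_Spec_eq_zero p K)]
  exact universallyInjective_absoluteFrobenius p _

end AnyField

/-- The inclusion of an open of a Noetherian scheme is quasi-compact (every subset of a Noetherian space is
compact). [folklore] -/
theorem quasiCompact_ι_of_isNoetherian {Y : Scheme.{0}} [IsNoetherian Y] (U : Y.Opens) : QuasiCompact U.ι := by
  refine ⟨fun V _ _ => ?_⟩
  haveI : NoetherianSpace Y := inferInstance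
  exact U.ι.isOpenEmbedding.isEmbedding.isCompact_iff.mpr (NoetherianSpace.isCompact _)

/-! ## The criterion pointwise -/

section PerfectConstants

variable (p : ℕ) [Fact p.Prime] (M : Type) [Field M] [CharP M p] [PerfectField M] {Y : Scheme.{0}}
  (q : Y ⟶ Spec (.of (RatFunc M))) [LocallyOfFiniteType q] [QuasiCompact q]

/-- **THE REGULAR-TWIST CRITERION, POINTWISE.** Over `K = M(t)` with `M` perfect of characteristic `p`, let
`q : Y → Spec K` be of finite type and `y'` a point of the Frobenius twist `Y^{(p)} = Y ×_{K,Frob} K`, over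
`y = pr₁ y'`. Then `q` is smooth on some open neighbourhood of `y` iff the local ring `𝒪_{Y^{(p)},y'}` is
regular. [cite: EGAIV2, Prop. 6.7.4] -/
theorem exists_smooth_nhds_iff_isRegularLocalRing_twist
    (y' : ↥(pullback q (Spec.map (CommRingCat.ofHom (frobenius (RatFunc M) p))))) :
    (∃ U : Y.Opens,
        (pullback.fst q (Spec.map (CommRingCat.ofHom (frobenius (RatFunc M) p))) y' : Y) ∈ U ∧
          Smooth (U.ι ≫ q)) ↔
      IsRegularLocalRing
        ((pullback q (Spec.map (CommRingCat.ofHom (frobenius (RatFunc M) p)))).presheaf.stalk y') := by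
  haveI : IsNoetherian Y := Scheme.isNoetherian_of_finiteType_over_field q
  -- the twist of an open `U ⊆ Y` is the open `pr₁⁻¹ U` of `Y^{(p)}`
  have key : ∀ U : Y.Opens,
      ∃ j : pullback (U.ι ≫ q) (Spec.map (CommRingCat.ofHom (frobenius (RatFunc M) p))) ⟶
          pullback q (Spec.map (CommRingCat.ofHom (frobenius (RatFunc M) p))),
        IsOpenImmersion j ∧
          Set.range j = (pullback.fst q (Spec.map (CommRingCat.ofHom (frobenius (RatFunc M) p)))) ⁻¹' (U : Set Y) := by
    intro U
    refine ⟨(pullbackRightPullbackFstIso q (Spec.map (CommRingCat.ofHom (frobenius (RatFunc M) p))) U.ι).inv ≫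
      pullback.snd U.ι (pullback.fst q (Spec.map (CommRingCat.ofHom (frobenius (RatFunc M) p)))),
      inferInstance, ?_⟩
    have hsurj : Function.Surjective
        (pullbackRightPullbackFstIso q (Spec.map (CommRingCat.ofHom (frobenius (RatFunc M) p))) U.ι).inv :=
      (pullbackRightPullbackFstIso q (Spec.map (CommRingCat.ofHom (frobenius (RatFunc M) p))) U.ι).inv.surjective
    rw [Scheme.Hom.comp_base, TopCat.coe_comp, Set.range_comp, Set.range_eq_univ.mpr hsurj, Set.image_univ,
      Scheme.Pullback.range_snd, Scheme.Opens.range_ι]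
  constructor
  · rintro ⟨U, hyU, hU⟩
    haveI : QuasiCompact U.ι := quasiCompact_ι_of_isNoetherian U
    have hreg := (smooth_iff_isRegular_frobeniusTwist M (U.ι ≫ q)).mp hU
    obtain ⟨j, hj, hrange⟩ := key U
    haveI := hj
    have hy' : y' ∈ Set.range j := by rw [hrange]; exact hyU
    obtain ⟨z, rfl⟩ := hy'
    exact (isRegularLocalRing_stalk_iff_of_isOpenImmersion j z).mpr (hreg z)
  · intro hy'
    -- the regular locus `W` of `Y^{(p)}` is open; `pr₁` is closed and injective, so `U := (pr₁ (Wᶜ))ᶜ` is an open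
    -- neighbourhood of `y` with `pr₁⁻¹ U ⊆ W`
    haveI := isIntegralHom_specMap_frobenius p (RatFunc M)
    haveI := universallyInjective_specMap_frobenius p (RatFunc M)
    haveI : UniversallyClosed (pullback.fst q (Spec.map (CommRingCat.ofHom (frobenius (RatFunc M) p)))) :=
      MorphismProperty.pullback_fst _ _ inferInstance
    haveI : UniversallyInjective (pullback.fst q (Spec.map (CommRingCat.ofHom (frobenius (RatFunc M) p)))) :=
      MorphismProperty.pullback_fst _ _ inferInstance
    have hWopen : IsOpen (Scheme.regularLocus
        (pullback q (Spec.map (CommRingCat.ofHom (frobenius (RatFunc M) p))))) :=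
      isOpen_regularLocus_of_locallyOfFiniteType_field
        (pullback.snd q (Spec.map (CommRingCat.ofHom (frobenius (RatFunc M) p))))
    have hUopen : IsOpen ((pullback.fst q (Spec.map (CommRingCat.ofHom (frobenius (RatFunc M) p)))) ''
        (Scheme.regularLocus (pullback q (Spec.map (CommRingCat.ofHom (frobenius (RatFunc M) p)))))ᶜ)ᶜ :=
      ((pullback.fst q _).isClosedMap _ hWopen.isClosed_compl).isOpen_compl
    refine ⟨⟨_, hUopen⟩, ?_, ?_⟩
    · rintro ⟨z, hz, hzy⟩
      apply hz
      rw [(pullback.fst q (Spec.map (CommRingCat.ofHom (frobenius (RatFunc M) p)))).injective hzy]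
      exact hy'
    · haveI : QuasiCompact (Scheme.Opens.ι ⟨_, hUopen⟩) := quasiCompact_ι_of_isNoetherian _
      refine (smooth_iff_isRegular_frobeniusTwist M (Scheme.Opens.ι ⟨_, hUopen⟩ ≫ q)).mpr fun z => ?_
      obtain ⟨j, hj, hrange⟩ := key ⟨_, hUopen⟩
      haveI := hj
      refine (isRegularLocalRing_stalk_iff_of_isOpenImmersion j z).mp ?_
      have hjz : j z ∈ Set.range j := ⟨z, rfl⟩
      rw [hrange] at hjz
      -- `pr₁ (j z) ∈ U`, i.e. `pr₁ (j z) ∉ pr₁ (Wᶜ)`; since `j z ↦ pr₁ (j z)`, `j z ∈ W`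
      by_contra hW
      exact hjz ⟨j z, hW, rfl⟩

/-- **The smooth locus is the image of the regular locus of the twist**: the set of points of `Y` near which `q`
is smooth equals `pr₁ (Reg Y^{(p)})`. [cite: EGAIV2, Prop. 6.7.4] -/
theorem smoothNhds_eq_image_regularLocus_twist :
    {y : Y | ∃ U : Y.Opens, y ∈ U ∧ Smooth (U.ι ≫ q)} =
      (pullback.fst q (Spec.map (CommRingCat.ofHom (frobenius (RatFunc M) p)))) ''
        Scheme.regularLocus (pullback q (Spec.map (CommRingCat.ofHom (frobenius (RatFunc M) p)))) := by
  haveI : Surjective (Spec.map (CommRingCat.ofHom (frobenius (RatFunc M) p))) :=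
    DeJong1996.Stage.surjective_specMap _
  haveI : Surjective (pullback.fst q (Spec.map (CommRingCat.ofHom (frobenius (RatFunc M) p)))) :=
    MorphismProperty.pullback_fst _ _ inferInstance
  ext y
  constructor
  · rintro hy
    obtain ⟨y', rfl⟩ := (pullback.fst q (Spec.map (CommRingCat.ofHom (frobenius (RatFunc M) p)))).surjective y
    exact ⟨y', (exists_smooth_nhds_iff_isRegularLocalRing_twist p M q y').mp hy, rfl⟩
  · rintro ⟨y', hy', rfl⟩
    exact (exists_smooth_nhds_iff_isRegularLocalRing_twist p M q y').mpr hy'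

omit [Fact p.Prime] [CharP M p] [PerfectField M] [LocallyOfFiniteType q] [QuasiCompact q] in
/-- The set of points near which `q` is smooth is open (a union of opens). [folklore] -/
theorem isOpen_smoothNhds : IsOpen {y : Y | ∃ U : Y.Opens, y ∈ U ∧ Smooth (U.ι ≫ q)} := by
  rw [isOpen_iff_forall_mem_open]
  rintro y ⟨U, hyU, hU⟩
  exact ⟨U, fun z hz => ⟨U, hz, hU⟩, U.isOpen, hyU⟩

end PerfectConstants

/-- **Global from local**: `q` is smooth iff it is smooth near every point — here recovered through the twist:
`Y^{(p)}` is regular iff it is regular at every point (`smooth_iff_isRegular_frobeniusTwist`). The prime `p` with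
`CharP M p` is an explicit argument (it does not occur in the statement). [cite: EGAIV2, Prop. 6.7.4] -/
theorem smooth_iff_forall_exists_smooth_nhds (p : ℕ) [Fact p.Prime] (M : Type) [Field M] [CharP M p]
    [PerfectField M] {Y : Scheme.{0}} (q : Y ⟶ Spec (.of (RatFunc M))) [LocallyOfFiniteType q] [QuasiCompact q] :
    Smooth q ↔ ∀ y : Y, ∃ U : Y.Opens, y ∈ U ∧ Smooth (U.ι ≫ q) := by
  constructor
  · intro h y
    exact ⟨⊤, trivial, inferInstance⟩
  · intro h
    haveI : Surjective (Spec.map (CommRingCat.ofHom (frobenius (RatFunc M) p))) :=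
      DeJong1996.Stage.surjective_specMap _
    haveI : Surjective (pullback.fst q (Spec.map (CommRingCat.ofHom (frobenius (RatFunc M) p)))) :=
      MorphismProperty.pullback_fst _ _ inferInstance
    refine (smooth_iff_isRegular_frobeniusTwist M q).mpr fun y' => ?_
    exact (exists_smooth_nhds_iff_isRegularLocalRing_twist p M q y').mp (h _)


/-! ## In Mathlib's vocabulary: the regular locus of the twist is the preimage of `Scheme.Hom.smoothLocus`
(appended by res-L1-s82-pv-1, gen 5) -/

section SmoothLocus

/-- **Mathlib's smooth locus is the set of points with a smooth open neighbourhood**: for `g : X → Y` locally of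
finite presentation, `x ∈ g.smoothLocus` iff `g` is smooth on some open `U ∋ x` (`Scheme.Hom.smoothLocus` is open,
`smoothLocus_eq_top_iff`, `preimage_smoothLocus_eq`). [folklore] -/
theorem mem_smoothLocus_iff_exists_smooth_nhds {X Y : Scheme.{0}} (g : X ⟶ Y) [LocallyOfFinitePresentation g]
    (x : X) : x ∈ g.smoothLocus ↔ ∃ U : X.Opens, x ∈ U ∧ Smooth (U.ι ≫ g) := by
  constructor
  · intro hx
    refine ⟨g.smoothLocus, hx, ?_⟩
    rw [← Scheme.Hom.smoothLocus_eq_top_iff, ← Scheme.Hom.preimage_smoothLocus_eq]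
    exact Scheme.Opens.ι_preimage_self _
  · rintro ⟨U, hxU, hU⟩
    haveI := hU
    have h := (U.ι ≫ g).smoothLocus_eq_top
    rw [← Scheme.Hom.preimage_smoothLocus_eq] at h
    obtain ⟨z, hz⟩ : x ∈ Set.range U.ι := by rw [Scheme.Opens.range_ι]; exact hxU
    have hz' : z ∈ U.ι ⁻¹ᵁ g.smoothLocus := by rw [h]; trivial
    change U.ι z ∈ g.smoothLocus at hz'
    rwa [hz] at hz'

variable (p : ℕ) [Fact p.Prime] (M : Type) [Field M] [CharP M p] [PerfectField M] {Y : Scheme.{0}}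
  (q : Y ⟶ Spec (.of (RatFunc M))) [LocallyOfFiniteType q] [QuasiCompact q] [LocallyOfFinitePresentation q]

/-- **THE REGULAR LOCUS OF THE FROBENIUS TWIST IS THE PREIMAGE OF THE SMOOTH LOCUS**: over `K = M(t)`, `M`
perfect, for `q : Y → Spec K` of finite type, `pr₁⁻¹ (sm q) = Reg (Y^{(p)})` as subsets of `Y^{(p)}`
(`Scheme.Hom.smoothLocus`, `Scheme.regularLocus`). (The instance `LocallyOfFinitePresentation q` holds for every `q`
locally of finite type over a field — tree `HodgeTheory.locallyOfFinitePresentation_of_isLocallyNoetherian` and its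
copies; it is taken as a hypothesis here to keep the imports small.) [cite: EGAIV2, Prop. 6.7.4] -/
theorem preimage_fst_smoothLocus_eq_regularLocus_twist :
    (pullback.fst q (Spec.map (CommRingCat.ofHom (frobenius (RatFunc M) p)))) ⁻¹' (q.smoothLocus : Set Y) =
      Scheme.regularLocus (pullback q (Spec.map (CommRingCat.ofHom (frobenius (RatFunc M) p)))) := by
  ext y'
  rw [Set.mem_preimage, SetLike.mem_coe, mem_smoothLocus_iff_exists_smooth_nhds]
  exact exists_smooth_nhds_iff_isRegularLocalRing_twist p M q y'

/-- **THE SMOOTH LOCUS IS THE IMAGE OF THE REGULAR LOCUS OF THE TWIST**: `sm q = pr₁ (Reg Y^{(p)})`; equivalently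
the NON-SMOOTH locus of `q` is `pr₁ (Sing Y^{(p)})` (`pr₁` is a bijection). [cite: EGAIV2, Prop. 6.7.4] -/
theorem smoothLocus_eq_image_regularLocus_twist :
    (q.smoothLocus : Set Y) =
      (pullback.fst q (Spec.map (CommRingCat.ofHom (frobenius (RatFunc M) p)))) ''
        Scheme.regularLocus (pullback q (Spec.map (CommRingCat.ofHom (frobenius (RatFunc M) p)))) := by
  haveI : Surjective (Spec.map (CommRingCat.ofHom (frobenius (RatFunc M) p))) :=
    DeJong1996.Stage.surjective_specMap _
  haveI : Surjective (pullback.fst q (Spec.map (CommRingCat.ofHom (frobenius (RatFunc M) p)))) :=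
    MorphismProperty.pullback_fst _ _ inferInstance
  rw [← preimage_fst_smoothLocus_eq_regularLocus_twist p M q,
    Set.image_preimage_eq _ (pullback.fst q _).surjective]

/-- **`q` is smooth iff `Sing(Y^{(p)}) = ∅`**, i.e. iff the regular locus of the twist is everything — the global
criterion `smooth_iff_isRegular_frobeniusTwist` read through `smoothLocus_eq_top_iff`. [cite: EGAIV2, Prop. 6.7.4] -/
theorem smooth_iff_regularLocus_twist_eq_univ :
    Smooth q ↔
      Scheme.regularLocus (pullback q (Spec.map (CommRingCat.ofHom (frobenius (RatFunc M) p)))) = Set.univ := by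
  rw [← preimage_fst_smoothLocus_eq_regularLocus_twist p M q, ← Scheme.Hom.smoothLocus_eq_top_iff (f := q)]
  haveI : Surjective (Spec.map (CommRingCat.ofHom (frobenius (RatFunc M) p))) :=
    DeJong1996.Stage.surjective_specMap _
  haveI : Surjective (pullback.fst q (Spec.map (CommRingCat.ofHom (frobenius (RatFunc M) p)))) :=
    MorphismProperty.pullback_fst _ _ inferInstance
  constructor
  · intro h; rw [h]; rfl
  · intro h
    apply le_antisymm le_top
    intro y _
    obtain ⟨y', rfl⟩ := (pullback.fst q (Spec.map (CommRingCat.ofHom (frobenius (RatFunc M) p)))).surjective y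
    have hy' : y' ∈ (pullback.fst q (Spec.map (CommRingCat.ofHom (frobenius (RatFunc M) p)))) ⁻¹'
        (q.smoothLocus : Set Y) := by rw [h]; trivial
    exact hy'

end SmoothLocus

end Summit.ResolutionOfSingularities.ResolutionOfSingularities.Theorems.CampaignW82

end
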